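import Mathlib
import HarnessLib
import Literature.Computability.AlgebraicComplexity.DiPatternExpressions
import Summits.ValiantsHypothesis.ValiantsHypothesis.Theorems.MonotoneRestorationOrbitCompressionQPReynoldsDescentFalse

/-!
# Route MonotoneRestoration — asides `OrbitCompressionQP` (stmt-ValiantsHypothesis-18332) / `OrbitRestorationLinearVolumeQP`
# (stmt-18294): ONE-SIDED REYNOLDS DESCENTS ARE FALSE TOO

Companion of `…OrbitCompressionQPReynoldsDescentFalse.lean` (p831166: the full `Sym_n × Sym_n` Reynolds sum of the treewidth-`0`
loop patterns produces the permanent, so Reynolds qp-descent is false).  The half-way operators between the one-sorted and the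
two-sorted world — decouple only the COLUMN sort (`x_ij ↦ x_{i, τ j}` summed over `τ ∈ Sym_n`) or only the ROW sort — already send
the diagonal product `Π_i x_ii` (a member of the span of the loop patterns, `ReynoldsDescentFalse.prod_X_diag_mem_span_loopPatterns`)
EXACTLY to `per_n`:

* `colReynolds_prod_X_diag` / `rowReynolds_prod_X_diag` — `Σ_τ Π_i x_{i, τ i} = per_n = Σ_σ Π_i x_{σ i, i}`;
* `perPoly_mem_of_colReynolds_loopPatterns_mem` / `…rowReynolds…` — if the one-sided symmetrisation of every loop pattern lies
  in a subspace `W`, then `per_n ∈ W`;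
* ★★ `not_colReynoldsDescent` / `not_rowReynoldsDescent` — **the one-sided Reynolds descents are false** (already at `c = 0`, against
  `OrbitRestorationQPHomPolyClose.perPoly_not_mem_narrowSpan`, Dawar–Wilsenach 2025 Thm 7.1 proved in the tree).

Meaning (honest label): no partial averaging of narrow one-sorted homomorphism polynomials stays inside the bipartite narrow span;
in S1c (`MatSym ∩ U_c(n) ⊆ W_{c'}(n)`) the matrix symmetry of `p` must be USED as a property of the given narrow expansion, not
manufactured by averaging.  S1c, the registered stubs, R1, the asides and VP ≠ VNP are NOT moved; def-free helper
(`--supports stmt-ValiantsHypothesis-18332`); nothing here is a named fact.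
-/

noncomputable section

open scoped Classical

-- `Summit.ValiantsHypothesis.ValiantsHypothesis.…` is the tree's single-conjunct layout (Sub = Summit).
set_option linter.dupNamespace false

namespace Summit.ValiantsHypothesis.ValiantsHypothesis.Theorems

namespace ReynoldsDescentFalseOneSided

open Literature.Computability.AlgebraicComplexity MvPolynomial
open Literature.Combinatorics.SimpleGraph (treewidth)
open ReynoldsDescentFalse (prod_X_diag_mem_span_loopPatterns treewidth_loopPattern_le)

/-! ### One-sided symmetrisation (columns only, or rows only) already produces the permanent

The half-way operators between the one-sorted and the two-sorted world — decouple only the COLUMN sort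
(`x_ij ↦ x_{i, τ j}`, summed over `τ ∈ Sym_n`) or only the ROW sort — send the diagonal product `Π_i x_ii` (a member
of the span of the treewidth-`0` loop patterns, `prod_X_diag_mem_span_loopPatterns`) EXACTLY to `per_n`.  Hence the
one-sided "Reynolds descents" fail as well: no partial averaging of narrow one-sorted homomorphism polynomials stays
narrow. -/

/-- **Column-Reynolds sum of the diagonal product**: `Σ_τ Π_i x_{i, τ i} = per_n`. [folklore] -/
theorem colReynolds_prod_X_diag (n : ℕ) :
    (∑ τ : Equiv.Perm (Fin n),
        rename (fun ij : Fin n × Fin n => (ij.1, τ ij.2))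
          (∏ i : Fin n, (X (i, i) : MvPolynomial (Fin n × Fin n) ℂ))) = perPoly (Fin n) ℂ := by
  have hper : perPoly (Fin n) ℂ = ∑ π : Equiv.Perm (Fin n), ∏ i : Fin n,
      (X (π i, i) : MvPolynomial (Fin n × Fin n) ℂ) := by
    unfold perPoly Matrix.permanent
    simp only [Matrix.mvPolynomialX_apply]
  simp only [map_prod, rename_X]
  rw [hper]
  have h1 : ∀ τ : Equiv.Perm (Fin n), (∏ i : Fin n, (X (i, τ i) : MvPolynomial (Fin n × Fin n) ℂ)) =
      ∏ j : Fin n, (X (τ⁻¹ j, j) : MvPolynomial (Fin n × Fin n) ℂ) := by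
    intro τ
    exact Fintype.prod_equiv τ _ _ fun i => by simp
  simp_rw [h1]
  exact Fintype.sum_equiv (Equiv.inv (Equiv.Perm (Fin n))) _ _ fun τ => rfl

/-- **Row-Reynolds sum of the diagonal product**: `Σ_σ Π_i x_{σ i, i} = per_n`. [folklore] -/
theorem rowReynolds_prod_X_diag (n : ℕ) :
    (∑ σ : Equiv.Perm (Fin n),
        rename (fun ij : Fin n × Fin n => (σ ij.1, ij.2))
          (∏ i : Fin n, (X (i, i) : MvPolynomial (Fin n × Fin n) ℂ))) = perPoly (Fin n) ℂ := by
  have hper : perPoly (Fin n) ℂ = ∑ π : Equiv.Perm (Fin n), ∏ i : Fin n,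
      (X (π i, i) : MvPolynomial (Fin n × Fin n) ℂ) := by
    unfold perPoly Matrix.permanent
    simp only [Matrix.mvPolynomialX_apply]
  simp only [map_prod, rename_X]
  rw [hper]

/-- ★ If the COLUMN-Reynolds sum of the `dihom` of every loop pattern at level `n` lies in a subspace `W`, then
`per_n ∈ W`. [folklore] -/
theorem perPoly_mem_of_colReynolds_loopPatterns_mem (n : ℕ) (W : Submodule ℂ (MvPolynomial (Fin n × Fin n) ℂ))
    (hW : ∀ (k : ℕ) (m : Fin k → ℕ),
      (∑ τ : Equiv.Perm (Fin n),
        rename (fun ij : Fin n × Fin n => (ij.1, τ ij.2))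
          (diHomPoly (∑ j : Fin k, Multiset.replicate (m j) (j, j) : Multiset (Fin k × Fin k)) n ℂ)) ∈ W) :
    perPoly (Fin n) ℂ ∈ W := by
  set RS : MvPolynomial (Fin n × Fin n) ℂ →ₗ[ℂ] MvPolynomial (Fin n × Fin n) ℂ :=
    ∑ τ : Equiv.Perm (Fin n),
      (rename (fun ij : Fin n × Fin n => (ij.1, τ ij.2)) :
        MvPolynomial (Fin n × Fin n) ℂ →ₐ[ℂ] MvPolynomial (Fin n × Fin n) ℂ).toLinearMap with hRS
  have hRS_apply : ∀ p : MvPolynomial (Fin n × Fin n) ℂ, RS p =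
      ∑ τ : Equiv.Perm (Fin n), rename (fun ij : Fin n × Fin n => (ij.1, τ ij.2)) p := by
    intro p
    simp [hRS, LinearMap.sum_apply]
  have hle : Submodule.span ℂ
      {q : MvPolynomial (Fin n × Fin n) ℂ | ∃ (k : ℕ) (m : Fin k → ℕ),
        q = diHomPoly (∑ j : Fin k, Multiset.replicate (m j) (j, j) : Multiset (Fin k × Fin k)) n ℂ} ≤
      W.comap RS := by
    refine Submodule.span_le.2 ?_
    rintro q ⟨k, m, rfl⟩
    show RS _ ∈ W
    rw [hRS_apply]
    exact hW k m
  have hmem := hle (prod_X_diag_mem_span_loopPatterns n)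
  rw [Submodule.mem_comap, hRS_apply, colReynolds_prod_X_diag] at hmem
  exact hmem

/-- ★ If the ROW-Reynolds sum of the `dihom` of every loop pattern at level `n` lies in a subspace `W`, then
`per_n ∈ W`. [folklore] -/
theorem perPoly_mem_of_rowReynolds_loopPatterns_mem (n : ℕ) (W : Submodule ℂ (MvPolynomial (Fin n × Fin n) ℂ))
    (hW : ∀ (k : ℕ) (m : Fin k → ℕ),
      (∑ σ : Equiv.Perm (Fin n),
        rename (fun ij : Fin n × Fin n => (σ ij.1, ij.2))
          (diHomPoly (∑ j : Fin k, Multiset.replicate (m j) (j, j) : Multiset (Fin k × Fin k)) n ℂ)) ∈ W) :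
    perPoly (Fin n) ℂ ∈ W := by
  set RS : MvPolynomial (Fin n × Fin n) ℂ →ₗ[ℂ] MvPolynomial (Fin n × Fin n) ℂ :=
    ∑ σ : Equiv.Perm (Fin n),
      (rename (fun ij : Fin n × Fin n => (σ ij.1, ij.2)) :
        MvPolynomial (Fin n × Fin n) ℂ →ₐ[ℂ] MvPolynomial (Fin n × Fin n) ℂ).toLinearMap with hRS
  have hRS_apply : ∀ p : MvPolynomial (Fin n × Fin n) ℂ, RS p =
      ∑ σ : Equiv.Perm (Fin n), rename (fun ij : Fin n × Fin n => (σ ij.1, ij.2)) p := by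
    intro p
    simp [hRS, LinearMap.sum_apply]
  have hle : Submodule.span ℂ
      {q : MvPolynomial (Fin n × Fin n) ℂ | ∃ (k : ℕ) (m : Fin k → ℕ),
        q = diHomPoly (∑ j : Fin k, Multiset.replicate (m j) (j, j) : Multiset (Fin k × Fin k)) n ℂ} ≤
      W.comap RS := by
    refine Submodule.span_le.2 ?_
    rintro q ⟨k, m, rfl⟩
    show RS _ ∈ W
    rw [hRS_apply]
    exact hW k m
  have hmem := hle (prod_X_diag_mem_span_loopPatterns n)
  rw [Submodule.mem_comap, hRS_apply, rowReynolds_prod_X_diag] at hmem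
  exact hmem

/-- ★★ **COLUMN-ONLY Reynolds descent is false**: "for every `c` some `c'` such that the column-symmetrisation
`Σ_τ dihom_{D,n}(x_{i, τ j})` of every pattern of treewidth `≤ (log₂ n + c)^c` lies in `W_{c'}(n)`" fails (already at `c = 0`,
loop patterns, via the permanent). [cite: DawarWilsenach2025, Thm. 7.1 (p. 18)] -/
theorem not_colReynoldsDescent :
    ¬ ∀ c : ℕ, ∃ c' : ℕ, ∀ (n a : ℕ) (D : Multiset (Fin a × Fin a)),
      treewidth (SimpleGraph.fromRel fun u v : Fin a => ∃ e ∈ D, u = e.1 ∧ v = e.2) ≤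
        (Nat.log 2 n + c) ^ c →
      (∑ τ : Equiv.Perm (Fin n),
          rename (fun ij : Fin n × Fin n => (ij.1, τ ij.2)) (diHomPoly D n ℂ)) ∈
        Submodule.span ℂ {q : MvPolynomial (Fin n × Fin n) ℂ | ∃ (a' b' : ℕ) (F : Multiset (Fin a' × Fin b')),
          treewidth (SimpleGraph.fromRel fun u v : Fin a' ⊕ Fin b' =>
              ∃ e ∈ F, u = Sum.inl e.1 ∧ v = Sum.inr e.2) ≤ (Nat.log 2 n + c') ^ c' ∧ q = homPoly F n ℂ} := by
  intro hR
  obtain ⟨c', hc'⟩ := hR 0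
  refine OrbitRestorationQPHomPolyClose.perPoly_not_mem_narrowSpan c' fun n => ?_
  refine perPoly_mem_of_colReynolds_loopPatterns_mem n _ fun k m => hc' n k _ ?_
  rw [pow_zero]
  exact (treewidth_loopPattern_le m).trans zero_le_one

/-- ★★ **ROW-ONLY Reynolds descent is false** (same statement for the row-symmetrisation `Σ_σ dihom_{D,n}(x_{σ i, j})`).
[cite: DawarWilsenach2025, Thm. 7.1 (p. 18)] -/
theorem not_rowReynoldsDescent :
    ¬ ∀ c : ℕ, ∃ c' : ℕ, ∀ (n a : ℕ) (D : Multiset (Fin a × Fin a)),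
      treewidth (SimpleGraph.fromRel fun u v : Fin a => ∃ e ∈ D, u = e.1 ∧ v = e.2) ≤
        (Nat.log 2 n + c) ^ c →
      (∑ σ : Equiv.Perm (Fin n),
          rename (fun ij : Fin n × Fin n => (σ ij.1, ij.2)) (diHomPoly D n ℂ)) ∈
        Submodule.span ℂ {q : MvPolynomial (Fin n × Fin n) ℂ | ∃ (a' b' : ℕ) (F : Multiset (Fin a' × Fin b')),
          treewidth (SimpleGraph.fromRel fun u v : Fin a' ⊕ Fin b' =>
              ∃ e ∈ F, u = Sum.inl e.1 ∧ v = Sum.inr e.2) ≤ (Nat.log 2 n + c') ^ c' ∧ q = homPoly F n ℂ} := by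
  intro hR
  obtain ⟨c', hc'⟩ := hR 0
  refine OrbitRestorationQPHomPolyClose.perPoly_not_mem_narrowSpan c' fun n => ?_
  refine perPoly_mem_of_rowReynolds_loopPatterns_mem n _ fun k m => hc' n k _ ?_
  rw [pow_zero]
  exact (treewidth_loopPattern_le m).trans zero_le_one

end ReynoldsDescentFalseOneSided

end Summit.ValiantsHypothesis.ValiantsHypothesis.Theorems

end
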